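import Summits.QuantumFields.BalabanUV.Beta.D1BFx.PackedKernelSplit

/-!
# `BalabanUV.Beta.D1BFx.GhostWordEnvelope` — road «BF-x» for binder row D1, slot (K), DICT-CHAIN-SPEC §2 (II) row RK-GH, «RK-GH-UNIT» FILE 1 («RK-GH-ENV»):
# **THE (1.22)-ENVELOPE OF A TADPOLE ∕ TWO-LEG BUBBLE WORD FROM ONE DECAYING LEG, ONE BOUNDED LEG AND THE CENTRED WEIGHTED ℓ¹-MASSES OF THE JETS**
# — generic dimension `D`, fibre `F`; no `Zl (rate)` volume factor is charged to the jets (they enter by MASS, not by `BiLoc`)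

HONEST DEPENDENCY (cell records, verbatim): «continuum YM on T⁴ ⇐ BetaPertH ∧ nine spine estimates (0/9 proved); BetaPertH ⇐ (D1) ∧ (D4) ∧
CAP+tail; G-an2-4 gates asym, D1 and NE2/3/4.»  HONEST FRAMING (cell contract, verbatim): «discharging `BetaPertH` makes Bałaban's UV stability
UNCONDITIONAL — a real constructive-QFT result; it is NOT the continuum limit and NOT the Clay problem.»  THIS MODULE DISCHARGES NOTHING of the
wall: it is [folklore] `ℓ¹` bookkeeping over an2's `ExpKernelCalculus` (`comp`, `tr`, `tadpole`, `Decays`), `KernelWard.Bdd` and leaf-03's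
`PackedKernelSplit.biBubble` (Mathlib `tsum_of_norm_bounded`, `Summable.prod_symm`∕`prod_factor`∕`prod`, `HasSum.prod_fiberwise`).  Every letter is a
DISPLAYED hypothesis on ARBITRARY kernels; nothing about Bałaban's operators is asserted.  No `def`, no `def … : Prop`, nothing cited, 0 sorry.
NO unit row is proved HERE (the rows are FILE 4 `RestKernelGhostUnit`); 0 root-level binders of row D1 discharged (hW ∕ hR-sockets ∕ hSX-socket ∕ D1Tel ∕
D1Rep — 0); (K) NOT closed; NOT D1, NOT `BetaPertH`, NOT continuum, NOT Clay.

ABSOLUTE RULE (cell charter, verbatim): «No internally-minted statement may enter as a cited fact. Every hypothesis is either kernel-proved in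
this package or a verbatim quotation of a PUBLISHED theorem with page reference. The manuscript(s) under audit are NOT citable for their own
disputed steps — they are the thing under adjudication; programme-internal (2001/route/tribunal) claims are never citable.»

WHY (`HOME/b2b-balaban-beta-d1-p2/DICT-CHAIN-SPEC.md` v1.2 §2 (II) row RK-GH «OPEN — after GH-DICT names the remainder»; the remainder IS named —
leaf-01's `RestKernelGhostWords.ghostWordK (Ggh n a) (Pgt n a) (n²•vertexRedF n ghCur) (n²•tableRedF n gh₁₁) i`, twelve words — and its
`absMoment₂_ghostWordK` (the `hMR` letter) is per-`n`; journal INTENT 1 «RK-GH-UNIT» [D1LEAF04-G18-ONLINE] with the located count F-d1leaf04-g18-1).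
The n-UNIFORM rows need an envelope whose constant is a PRODUCT OF LETTERS with no hidden `n`-power.  The `BiLoc`∕`VertexFamily` currency of
`PackedKernelSplitBounds.abs_biBubble_le` charges `Zl D (δ)` per free lattice sum — four of them — and at the road's rates `δ ~ 1∕n` each is `~ n⁴`:
the near-diagonal packed jets (supported on `|x − z|₁ ≤ 1` per stencil) are read there as full block × block kernels.  HERE the jets enter through
their CENTRED WEIGHTED ℓ¹-MASSES `Σ'_{(x,z)} Σ_{g f} |V x z g f|·e^{σ(|x − c|₁ + |z − c|₁)}`, ONE leg through a `Decays` letter (it transports the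
decay from one jet's centre to the other's), the OTHER leg through a plain sup `Bdd`; the (1.22)-envelope is then `S₁·S₂·m·m′·e^{−σ|c′ − c|₁}` —
at the road's letters (FILE 2: `Pgt`'s sharp sup `cPPs·n⁻⁴` on one leg; FILE 3: packed-jet masses `O(n)`) every ghost word closes at `O(n⁻²)`.

CONTENT (all [folklore]; `L L₁ L₂ V V′ W : MKer D F`, centres `c c′ : Site D`, weight rate `0 ≤ σ`):
* §1 tools: `abs_sum_mul_le` (a finite fibre sum), `exp_weight_left` ∕ `exp_weight_pair` (the two exponential book-keepings), `summable_section_snd` ∕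
  `summable_tsum_snd` ∕ `tsum_section_le` (sections and Fubini of a nonnegative summable function on `Site D × Site D`, second index fixed).
* §2 ONE LEG AGAINST ONE JET, column by column: **`abs_comp_le_of_decays`** (`Decays L S σ`:
  `|comp L V x z a f| ≤ S·e^{−σ|x − c|₁}·ρ_V(z,f)`, `ρ_V(z,f) := Σ'_y Σ_g |V y z g f|·e^{σ(|y − c|₁ + |z − c|₁)}`) and **`abs_comp_le_of_bdd`** (`Bdd L S`:
  `|comp L V x z a f| ≤ S·e^{−σ|z − c|₁}·ρ_V(z,f)`).
* §3 **`abs_tr_comp_le_of_separable`**: `|A x z a f| ≤ α x·ρ z f`, `|B z x f a| ≤ β z·κ x a` (nonnegative, `x ↦ α x·Σ_a κ x a` and `z ↦ β z·Σ_f ρ z f`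
  summable) ⊢ `|tr (comp A B)| ≤ (Σ'_x α x·Σ_a κ x a)·(Σ'_z β z·Σ_f ρ z f)`.
* §4 THE WORDS: **`abs_tadpole_le_of_bdd_mass`** (`|tadpole L W| ≤ S·‖W‖₁`); `summable_section_fibre`, `sum_profile_eq` (column profiles of a weighted
  mass); **`abs_biBubble_le_of_decays_bdd_mass`** (decay on `L₁`): `|biBubble L₁ V L₂ V′| ≤ S₁·S₂·M_V(c)·M_{V′}(c′)·e^{−σ|c′ − c|₁}`.
NOT HERE (honest): the mirror (decay on `L₂`) and the word FAMILIES as (5.10)-kernels — companion file `GhostWordFamilies` (FILE 1b, the 400-line rule);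
the road's leg letters (FILE 2), the packed ghost jets' masses (FILE 3), the twelve rows (FILE 4); any statement about `Ggh`, `Pgt`, `wH`.
Unit `b2b-balaban-beta-d1-formalise-leaf-04` (gen 18), D1 formalisation swarm leaf prover 04, road «BF-x»; INTENT 1 «RK-GH-UNIT» FILE 1a (journal).
-/

noncomputable section

open Finset
open scoped BigOperators
open Literature.MathematicalPhysics.QuantumFieldTheory.Balaban1983to89
open Literature.MathematicalPhysics.QuantumFieldTheory.Balaban1983to89.Beta
open B12Sec2to5 (l1 l1_nonneg Decay510)
open ExpKernelCalculus (Site MKer Decays comp tr tadpole l1_sub_triangle l1_sub_symm l1_natSmul)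
open KernelWard (Bdd)
open Summit.QuantumFields.BalabanUV.Beta.D1BFx.PackedKernelSplit (biBubble)

namespace Summit.QuantumFields.BalabanUV.Beta.D1BFx.GhostWordEnvelope

variable {D : ℕ} {F : Type*} [Fintype F]

/-! ## §1 Tools -/

omit [Fintype F] in
/-- [folklore] A finite sum of products against termwise bounds: `|Σ_g a g·b g| ≤ Σ_g A g·|b g|` when `|a g| ≤ A g`. -/
theorem abs_sum_mul_le (s : Finset F) (a b : F → ℝ) {A : F → ℝ} (h : ∀ g, |a g| ≤ A g) :
    |∑ g ∈ s, a g * b g| ≤ ∑ g ∈ s, A g * |b g| :=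
  (Finset.abs_sum_le_sum_abs _ _).trans (Finset.sum_le_sum fun g _ => by
    rw [abs_mul]; exact mul_le_mul_of_nonneg_right (h g) (abs_nonneg _))

/-- [folklore] Transporting a decay from `y` to the centre `c`: `e^{−σ|x − y|₁} ≤ e^{−σ|x − c|₁}·e^{σ(|y − c|₁ + |z − c|₁)}` (`0 ≤ σ`; the extra
`|z − c|₁ ≥ 0` is free). -/
theorem exp_weight_left {σ : ℝ} (hσ : 0 ≤ σ) (x y z c : Site D) :
    Real.exp (-σ * l1 (x - y)) ≤ Real.exp (-σ * l1 (x - c)) * Real.exp (σ * (l1 (y - c) + l1 (z - c))) := by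
  rw [← Real.exp_add]
  apply Real.exp_le_exp.2
  have t : l1 (x - c) ≤ l1 (x - y) + l1 (y - c) := l1_sub_triangle x y c
  have hz := l1_nonneg (z - c)
  nlinarith [mul_nonneg hσ hz, mul_nonneg hσ (show 0 ≤ l1 (x - y) + l1 (y - c) - l1 (x - c) by linarith)]

/-- [folklore] A bounded leg borrows the weight: `1 ≤ e^{−σ|z − c|₁}·e^{σ(|y − c|₁ + |z − c|₁)}` (`0 ≤ σ`). -/
theorem one_le_exp_weight {σ : ℝ} (hσ : 0 ≤ σ) (y z c : Site D) :
    (1 : ℝ) ≤ Real.exp (-σ * l1 (z - c)) * Real.exp (σ * (l1 (y - c) + l1 (z - c))) := by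
  rw [← Real.exp_add, ← Real.exp_zero]
  apply Real.exp_le_exp.2
  have hy := l1_nonneg (y - c)
  nlinarith [mul_nonneg hσ hy]

/-- [folklore] The two centres: `e^{−σ|x − c|₁}·e^{−σ|x − c′|₁} ≤ e^{−σ|c′ − c|₁}` (`0 ≤ σ`). -/
theorem exp_weight_pair {σ : ℝ} (hσ : 0 ≤ σ) (x c c' : Site D) :
    Real.exp (-σ * l1 (x - c)) * Real.exp (-σ * l1 (x - c')) ≤ Real.exp (-σ * l1 (c' - c)) := by
  rw [← Real.exp_add]
  apply Real.exp_le_exp.2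
  have t : l1 (c' - c) ≤ l1 (c' - x) + l1 (x - c) := l1_sub_triangle c' x c
  rw [l1_sub_symm c' x] at t
  nlinarith [mul_nonneg hσ (show 0 ≤ l1 (x - c') + l1 (x - c) - l1 (c' - c) by linarith)]

/-- [folklore] SECTIONS of a summable function of two lattice points, SECOND point fixed: `y ↦ Φ y z` is summable. -/
theorem summable_section_snd {Φ : Site D → Site D → ℝ} (hΦ : Summable fun p : Site D × Site D => Φ p.1 p.2) (z : Site D) :
    Summable fun y : Site D => Φ y z :=
  hΦ.prod_symm.prod_factor z

/-- [folklore] … the column sums `z ↦ Σ'_y Φ y z` are summable … -/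
theorem summable_tsum_snd {Φ : Site D → Site D → ℝ} (hΦ : Summable fun p : Site D × Site D => Φ p.1 p.2) :
    Summable fun z : Site D => ∑' y : Site D, Φ y z :=
  hΦ.prod_symm.prod

/-- [folklore] … and their sum is the full sum: `Σ'_z Σ'_y Φ y z = Σ'_p Φ p.1 p.2`. -/
theorem tsum_tsum_snd_eq {Φ : Site D → Site D → ℝ} (hΦ : Summable fun p : Site D × Site D => Φ p.1 p.2) :
    ∑' z : Site D, ∑' y : Site D, Φ y z = ∑' p : Site D × Site D, Φ p.1 p.2 := by
  have hs : Summable fun p : Site D × Site D => Φ p.2 p.1 := hΦ.prod_symm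
  have h1 : ∑' p : Site D × Site D, Φ p.2 p.1 = ∑' z : Site D, ∑' y : Site D, Φ y z :=
    (hs.hasSum.prod_fiberwise fun z => (hs.prod_factor z).hasSum).tsum_eq.symm
  rw [← h1]
  exact (Equiv.prodComm (Site D) (Site D)).tsum_eq (fun p : Site D × Site D => Φ p.1 p.2)

/-! ## §2 One leg against one jet, column by column -/

/-- [folklore] **DECAYING LEG × JET, COLUMN PROFILE**: `Decays L S σ` (`0 ≤ σ`, `0 ≤ S`) and a summable weighted column of `V` give
`|comp L V x z a f| ≤ S·e^{−σ|x − c|₁}·Σ'_y Σ_g |V y z g f|·e^{σ(|y − c|₁ + |z − c|₁)}`. -/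
theorem abs_comp_le_of_decays {L V : MKer D F} {S σ : ℝ} (c : Site D) (hL : Decays L S σ) (hσ : 0 ≤ σ) (hS : 0 ≤ S)
    (x z : Site D) (a f : F) (hs : Summable fun y : Site D => ∑ g, |V y z g f| * Real.exp (σ * (l1 (y - c) + l1 (z - c)))) :
    |comp L V x z a f| ≤ S * Real.exp (-σ * l1 (x - c)) * ∑' y, ∑ g, |V y z g f| * Real.exp (σ * (l1 (y - c) + l1 (z - c))) := by
  unfold ExpKernelCalculus.comp
  have hmaj := hs.mul_left (S * Real.exp (-σ * l1 (x - c)))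
  have hb := tsum_of_norm_bounded (f := fun y => ∑ g, L x y a g * V y z g f) hmaj.hasSum (fun y => by
    rw [Real.norm_eq_abs]
    calc |∑ g, L x y a g * V y z g f| ≤ ∑ g, (S * Real.exp (-σ * l1 (x - y))) * |V y z g f| :=
          abs_sum_mul_le Finset.univ (fun g => L x y a g) (fun g => V y z g f) (fun g => hL x y a g)
      _ ≤ ∑ g, S * Real.exp (-σ * l1 (x - c)) * (|V y z g f| * Real.exp (σ * (l1 (y - c) + l1 (z - c)))) :=
          Finset.sum_le_sum fun g _ => by
            have hw := exp_weight_left hσ x y z c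
            have hV := abs_nonneg (V y z g f)
            calc S * Real.exp (-σ * l1 (x - y)) * |V y z g f|
                ≤ S * (Real.exp (-σ * l1 (x - c)) * Real.exp (σ * (l1 (y - c) + l1 (z - c)))) * |V y z g f| :=
                  mul_le_mul_of_nonneg_right (mul_le_mul_of_nonneg_left hw hS) hV
              _ = S * Real.exp (-σ * l1 (x - c)) * (|V y z g f| * Real.exp (σ * (l1 (y - c) + l1 (z - c)))) := by ring
      _ = S * Real.exp (-σ * l1 (x - c)) * ∑ g, |V y z g f| * Real.exp (σ * (l1 (y - c) + l1 (z - c))) := by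
          rw [Finset.mul_sum])
  rw [Real.norm_eq_abs, tsum_mul_left] at hb
  exact hb

/-- [folklore] **BOUNDED LEG × JET, COLUMN PROFILE**: `Bdd L S` (`0 ≤ S`, any `0 ≤ σ`) and a summable weighted column of `V` give
`|comp L V x z a f| ≤ S·e^{−σ|z − c|₁}·Σ'_y Σ_g |V y z g f|·e^{σ(|y − c|₁ + |z − c|₁)}` (the weight is borrowed from the column's own index `z`). -/
theorem abs_comp_le_of_bdd {L V : MKer D F} {S σ : ℝ} (c : Site D) (hL : Bdd L S) (hσ : 0 ≤ σ) (hS : 0 ≤ S)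
    (x z : Site D) (a f : F) (hs : Summable fun y : Site D => ∑ g, |V y z g f| * Real.exp (σ * (l1 (y - c) + l1 (z - c)))) :
    |comp L V x z a f| ≤ S * Real.exp (-σ * l1 (z - c)) * ∑' y, ∑ g, |V y z g f| * Real.exp (σ * (l1 (y - c) + l1 (z - c))) := by
  unfold ExpKernelCalculus.comp
  have hmaj := hs.mul_left (S * Real.exp (-σ * l1 (z - c)))
  have hb := tsum_of_norm_bounded (f := fun y => ∑ g, L x y a g * V y z g f) hmaj.hasSum (fun y => by
    rw [Real.norm_eq_abs]
    calc |∑ g, L x y a g * V y z g f| ≤ ∑ g, S * |V y z g f| :=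
          abs_sum_mul_le Finset.univ (fun g => L x y a g) (fun g => V y z g f) (fun g => hL x y a g)
      _ ≤ ∑ g, S * Real.exp (-σ * l1 (z - c)) * (|V y z g f| * Real.exp (σ * (l1 (y - c) + l1 (z - c)))) :=
          Finset.sum_le_sum fun g _ => by
            have hw := one_le_exp_weight hσ y z c
            have hV := abs_nonneg (V y z g f)
            calc S * |V y z g f| = S * 1 * |V y z g f| := by ring
              _ ≤ S * (Real.exp (-σ * l1 (z - c)) * Real.exp (σ * (l1 (y - c) + l1 (z - c)))) * |V y z g f| :=
                  mul_le_mul_of_nonneg_right (mul_le_mul_of_nonneg_left hw hS) hV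
              _ = S * Real.exp (-σ * l1 (z - c)) * (|V y z g f| * Real.exp (σ * (l1 (y - c) + l1 (z - c)))) := by ring
      _ = S * Real.exp (-σ * l1 (z - c)) * ∑ g, |V y z g f| * Real.exp (σ * (l1 (y - c) + l1 (z - c))) := by
          rw [Finset.mul_sum])
  rw [Real.norm_eq_abs, tsum_mul_left] at hb
  exact hb

/-! ## §3 The trace of a product under separable majorants -/

/-- [folklore] **SEPARABLE MAJORANTS ⇒ FACTORISED TRACE BOUND**: if `|A x z a f| ≤ α x·ρ z f` and `|B z x f a| ≤ β z·κ x a` with nonnegative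
factors, `x ↦ α x·Σ_a κ x a` and `z ↦ β z·Σ_f ρ z f` summable, then `|tr (comp A B)| ≤ (Σ'_x α x·Σ_a κ x a)·(Σ'_z β z·Σ_f ρ z f)`. -/
theorem abs_tr_comp_le_of_separable {A B : MKer D F} {α β : Site D → ℝ} {ρ κ : Site D → F → ℝ}
    (hA : ∀ x z a f, |A x z a f| ≤ α x * ρ z f) (hB : ∀ z x f a, |B z x f a| ≤ β z * κ x a)
    (hα : ∀ x, 0 ≤ α x) (hρ : ∀ z f, 0 ≤ ρ z f)
    (hxs : Summable fun x => α x * ∑ a, κ x a) (hzs : Summable fun z => β z * ∑ f, ρ z f) :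
    |tr (comp A B)| ≤ (∑' x, α x * ∑ a, κ x a) * (∑' z, β z * ∑ f, ρ z f) := by
  set T : ℝ := ∑' z, β z * ∑ f, ρ z f with hT
  -- inner sum, `x a` fixed
  have hinner : ∀ x a, |comp A B x x a a| ≤ α x * κ x a * T := by
    intro x a
    unfold ExpKernelCalculus.comp
    have hmaj := hzs.mul_left (α x * κ x a)
    have hb := tsum_of_norm_bounded (f := fun z => ∑ f, A x z a f * B z x f a) hmaj.hasSum (fun z => by
      rw [Real.norm_eq_abs]
      calc |∑ f, A x z a f * B z x f a| ≤ ∑ f, |A x z a f * B z x f a| := Finset.abs_sum_le_sum_abs _ _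
        _ ≤ ∑ f, (α x * ρ z f) * (β z * κ x a) := Finset.sum_le_sum fun f _ => by
            rw [abs_mul]; exact mul_le_mul (hA x z a f) (hB z x f a) (abs_nonneg _) (mul_nonneg (hα x) (hρ z f))
        _ = α x * κ x a * (β z * ∑ f, ρ z f) := by
            rw [Finset.mul_sum, Finset.mul_sum]; exact Finset.sum_congr rfl fun f _ => by ring)
    rw [Real.norm_eq_abs, tsum_mul_left] at hb
    exact hb
  -- outer sum
  unfold ExpKernelCalculus.tr
  have hmaj := hxs.mul_right T
  have hb := tsum_of_norm_bounded (f := fun x => ∑ a, comp A B x x a a) hmaj.hasSum (fun x => by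
    rw [Real.norm_eq_abs]
    calc |∑ a, comp A B x x a a| ≤ ∑ a, |comp A B x x a a| := Finset.abs_sum_le_sum_abs _ _
      _ ≤ ∑ a, α x * κ x a * T := Finset.sum_le_sum fun a _ => hinner x a
      _ = α x * (∑ a, κ x a) * T := by rw [Finset.mul_sum, Finset.sum_mul])
  rw [Real.norm_eq_abs, tsum_mul_right] at hb
  exact hb

/-! ## §4 The words -/

/-- [folklore] **THE TADPOLE WORD AGAINST A BOUNDED LEG**: `Bdd L S` (`0 ≤ S`) and an absolutely summable table `W` give
`|tadpole L W| ≤ S·Σ'_{(y,x)} Σ_{g a} |W y x g a|`. -/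
theorem abs_tadpole_le_of_bdd_mass {L W : MKer D F} {S : ℝ} (hL : Bdd L S)
    (hW : Summable fun p : Site D × Site D => ∑ g, ∑ a, |W p.1 p.2 g a|) :
    |tadpole L W| ≤ S * ∑' p : Site D × Site D, ∑ g, ∑ a, |W p.1 p.2 g a| := by
  have hsec : ∀ x, Summable fun y : Site D => ∑ g, ∑ a, |W y x g a| := fun x =>
    summable_section_snd (Φ := fun y x => ∑ g, ∑ a, |W y x g a|) hW x
  have hseca : ∀ x a, Summable fun y : Site D => ∑ g, |W y x g a| := fun x a =>
    Summable.of_nonneg_of_le (fun y => Finset.sum_nonneg fun g _ => abs_nonneg _)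
      (fun y => Finset.sum_le_sum fun g _ =>
        Finset.single_le_sum (f := fun a' => |W y x g a'|) (fun a' _ => abs_nonneg _) (Finset.mem_univ a))
      (hsec x)
  have hcol : Summable fun x : Site D => ∑' y : Site D, ∑ g, ∑ a, |W y x g a| :=
    summable_tsum_snd (Φ := fun y x => ∑ g, ∑ a, |W y x g a|) hW
  -- inner sum, `x a` fixed
  have hinner : ∀ x a, |comp L W x x a a| ≤ S * ∑' y : Site D, ∑ g, |W y x g a| := by
    intro x a
    unfold ExpKernelCalculus.comp
    have hmaj := (hseca x a).mul_left S
    have hb := tsum_of_norm_bounded (f := fun y => ∑ g, L x y a g * W y x g a) hmaj.hasSum (fun y => by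
      rw [Real.norm_eq_abs, Finset.mul_sum]
      exact abs_sum_mul_le Finset.univ (fun g => L x y a g) (fun g => W y x g a) (fun g => hL x y a g))
    rw [Real.norm_eq_abs, tsum_mul_left] at hb
    exact hb
  -- the fibre sum of the inner majorants is the column mass
  have hfib : ∀ x, ∑ a, S * ∑' y : Site D, ∑ g, |W y x g a| = S * ∑' y : Site D, ∑ g, ∑ a, |W y x g a| := by
    intro x
    rw [← Finset.mul_sum, ← Summable.tsum_finsetSum (fun a _ => hseca x a)]
    congr 1
    exact tsum_congr fun y => Finset.sum_comm
  -- outer sum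
  unfold ExpKernelCalculus.tadpole ExpKernelCalculus.tr
  have hmaj := hcol.mul_left S
  have hb := tsum_of_norm_bounded (f := fun x => ∑ a, comp L W x x a a) hmaj.hasSum (fun x => by
    rw [Real.norm_eq_abs]
    calc |∑ a, comp L W x x a a| ≤ ∑ a, |comp L W x x a a| := Finset.abs_sum_le_sum_abs _ _
      _ ≤ ∑ a, S * ∑' y : Site D, ∑ g, |W y x g a| := Finset.sum_le_sum fun a _ => hinner x a
      _ = S * ∑' y : Site D, ∑ g, ∑ a, |W y x g a| := hfib x)
  rw [Real.norm_eq_abs, tsum_mul_left, tsum_tsum_snd_eq (Φ := fun y x => ∑ g, ∑ a, |W y x g a|) hW] at hb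
  exact hb

section Bubble

variable {L₁ L₂ V V' : MKer D F} {S₁ S₂ σ : ℝ}

/-- [folklore] Sections of a centred weighted mass, one fibre index kept. -/
theorem summable_section_fibre (c : Site D)
    (hV : Summable fun p : Site D × Site D => ∑ g, ∑ f, |V p.1 p.2 g f| * Real.exp (σ * (l1 (p.1 - c) + l1 (p.2 - c))))
    (z : Site D) (f : F) :
    Summable fun y : Site D => ∑ g, |V y z g f| * Real.exp (σ * (l1 (y - c) + l1 (z - c))) :=
  Summable.of_nonneg_of_le (fun y => Finset.sum_nonneg fun g _ => by positivity)
    (fun y => Finset.sum_le_sum fun g _ =>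
      Finset.single_le_sum (f := fun f' => |V y z g f'| * Real.exp (σ * (l1 (y - c) + l1 (z - c)))) (fun f' _ => by positivity)
        (Finset.mem_univ f))
    (summable_section_snd (Φ := fun y z => ∑ g, ∑ f, |V y z g f| * Real.exp (σ * (l1 (y - c) + l1 (z - c)))) hV z)

/-- [folklore] The fibre sum of the column profiles is the column mass. -/
theorem sum_profile_eq (c : Site D)
    (hV : Summable fun p : Site D × Site D => ∑ g, ∑ f, |V p.1 p.2 g f| * Real.exp (σ * (l1 (p.1 - c) + l1 (p.2 - c))))
    (z : Site D) :
    ∑ f, ∑' y : Site D, ∑ g, |V y z g f| * Real.exp (σ * (l1 (y - c) + l1 (z - c)))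
      = ∑' y : Site D, ∑ g, ∑ f, |V y z g f| * Real.exp (σ * (l1 (y - c) + l1 (z - c))) := by
  rw [← Summable.tsum_finsetSum (fun f _ => summable_section_fibre c hV z f)]
  exact tsum_congr fun y => Finset.sum_comm

/-- [folklore] **THE TWO-LEG BUBBLE WORD, DECAY ON THE FIRST LEG**: `Decays L₁ S₁ σ`, `Bdd L₂ S₂` (`0 ≤ σ, S₁, S₂`), jets `V`, `V′` with summable
centred weighted masses at `c`, `c′` ⊢
`|biBubble L₁ V L₂ V′| ≤ S₁·S₂·(Σ' weighted mass of V at c)·(Σ' weighted mass of V′ at c′)·e^{−σ|c′ − c|₁}`. -/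
theorem abs_biBubble_le_of_decays_bdd_mass (c c' : Site D)
    (hL₁ : Decays L₁ S₁ σ) (hL₂ : Bdd L₂ S₂) (hσ : 0 ≤ σ) (hS₁ : 0 ≤ S₁) (hS₂ : 0 ≤ S₂)
    (hV : Summable fun p : Site D × Site D => ∑ g, ∑ f, |V p.1 p.2 g f| * Real.exp (σ * (l1 (p.1 - c) + l1 (p.2 - c))))
    (hV' : Summable fun p : Site D × Site D => ∑ g, ∑ f, |V' p.1 p.2 g f| * Real.exp (σ * (l1 (p.1 - c') + l1 (p.2 - c')))) :
    |biBubble L₁ V L₂ V'| ≤ S₁ * S₂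
      * (∑' p : Site D × Site D, ∑ g, ∑ f, |V p.1 p.2 g f| * Real.exp (σ * (l1 (p.1 - c) + l1 (p.2 - c))))
      * (∑' p : Site D × Site D, ∑ g, ∑ f, |V' p.1 p.2 g f| * Real.exp (σ * (l1 (p.1 - c') + l1 (p.2 - c'))))
      * Real.exp (-σ * l1 (c' - c)) := by
  -- the two separable majorants (column profiles `ρ` of `V` at `c`, `κ` of `V′` at `c′`)
  have hA : ∀ x z a f, |comp L₁ V x z a f| ≤ (S₁ * Real.exp (-σ * l1 (x - c)))
      * (∑' y : Site D, ∑ g, |V y z g f| * Real.exp (σ * (l1 (y - c) + l1 (z - c)))) := fun x z a f =>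
    abs_comp_le_of_decays c hL₁ hσ hS₁ x z a f (summable_section_fibre c hV z f)
  have hB : ∀ z x f a, |comp L₂ V' z x f a| ≤ (1 : ℝ) * ((S₂ * Real.exp (-σ * l1 (x - c')))
      * ∑' w : Site D, ∑ h, |V' w x h a| * Real.exp (σ * (l1 (w - c') + l1 (x - c')))) := fun z x f a => by
    rw [one_mul]; exact abs_comp_le_of_bdd c' hL₂ hσ hS₂ z x f a (summable_section_fibre c' hV' x a)
  -- summabilities of the factorised majorants
  have hcolV := summable_tsum_snd (Φ := fun y z => ∑ g, ∑ f, |V y z g f| * Real.exp (σ * (l1 (y - c) + l1 (z - c)))) hV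
  have hcolV' := summable_tsum_snd (Φ := fun w x => ∑ h, ∑ a, |V' w x h a| * Real.exp (σ * (l1 (w - c') + l1 (x - c')))) hV'
  have hzs : Summable fun z : Site D => (1 : ℝ) * ∑ f, ∑' y : Site D, ∑ g, |V y z g f| * Real.exp (σ * (l1 (y - c) + l1 (z - c))) := by
    refine hcolV.congr fun z => ?_
    rw [one_mul, sum_profile_eq c hV z]
  have hpt : ∀ x, S₁ * Real.exp (-σ * l1 (x - c)) * ∑ a, (S₂ * Real.exp (-σ * l1 (x - c')))
        * ∑' w : Site D, ∑ h, |V' w x h a| * Real.exp (σ * (l1 (w - c') + l1 (x - c')))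
      ≤ S₁ * S₂ * Real.exp (-σ * l1 (c' - c))
        * ∑' w : Site D, ∑ h, ∑ a, |V' w x h a| * Real.exp (σ * (l1 (w - c') + l1 (x - c'))) := by
    intro x
    rw [← Finset.mul_sum, sum_profile_eq c' hV' x]
    have hw := exp_weight_pair hσ x c c'
    have hm : 0 ≤ ∑' w : Site D, ∑ h, ∑ a, |V' w x h a| * Real.exp (σ * (l1 (w - c') + l1 (x - c'))) :=
      tsum_nonneg fun w => Finset.sum_nonneg fun h _ => Finset.sum_nonneg fun a _ => by positivity
    calc S₁ * Real.exp (-σ * l1 (x - c)) * (S₂ * Real.exp (-σ * l1 (x - c')) * _)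
        = (S₁ * S₂) * (Real.exp (-σ * l1 (x - c)) * Real.exp (-σ * l1 (x - c'))) * _ := by ring
      _ ≤ (S₁ * S₂) * Real.exp (-σ * l1 (c' - c)) * _ :=
          mul_le_mul_of_nonneg_right (mul_le_mul_of_nonneg_left hw (mul_nonneg hS₁ hS₂)) hm
  have hxs : Summable fun x : Site D => S₁ * Real.exp (-σ * l1 (x - c)) * ∑ a, (S₂ * Real.exp (-σ * l1 (x - c')))
      * ∑' w : Site D, ∑ h, |V' w x h a| * Real.exp (σ * (l1 (w - c') + l1 (x - c'))) :=
    Summable.of_nonneg_of_le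
      (fun x => mul_nonneg (by positivity) (Finset.sum_nonneg fun a _ => mul_nonneg (by positivity)
        (tsum_nonneg fun w => Finset.sum_nonneg fun h _ => by positivity)))
      hpt (hcolV'.mul_left (S₁ * S₂ * Real.exp (-σ * l1 (c' - c))))
  -- the factorised trace bound
  have h := abs_tr_comp_le_of_separable (A := comp L₁ V) (B := comp L₂ V')
    (α := fun x => S₁ * Real.exp (-σ * l1 (x - c)))
    (ρ := fun z f => ∑' y : Site D, ∑ g, |V y z g f| * Real.exp (σ * (l1 (y - c) + l1 (z - c))))
    (β := fun _ => (1 : ℝ))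
    (κ := fun x a => (S₂ * Real.exp (-σ * l1 (x - c'))) * ∑' w : Site D, ∑ h, |V' w x h a| * Real.exp (σ * (l1 (w - c') + l1 (x - c'))))
    hA hB (fun x => by positivity) (fun z f => tsum_nonneg fun y => Finset.sum_nonneg fun g _ => by positivity) hxs hzs
  unfold PackedKernelSplit.biBubble
  refine h.trans ?_
  -- evaluate the `z`-factor, bound the `x`-factor
  have hz : ∑' z : Site D, (1 : ℝ) * ∑ f, ∑' y : Site D, ∑ g, |V y z g f| * Real.exp (σ * (l1 (y - c) + l1 (z - c)))
      = ∑' p : Site D × Site D, ∑ g, ∑ f, |V p.1 p.2 g f| * Real.exp (σ * (l1 (p.1 - c) + l1 (p.2 - c))) := by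
    rw [← tsum_tsum_snd_eq (Φ := fun y z => ∑ g, ∑ f, |V y z g f| * Real.exp (σ * (l1 (y - c) + l1 (z - c)))) hV]
    exact tsum_congr fun z => by rw [one_mul, sum_profile_eq c hV z]
  have hx : ∑' x : Site D, S₁ * Real.exp (-σ * l1 (x - c)) * ∑ a, (S₂ * Real.exp (-σ * l1 (x - c')))
        * ∑' w : Site D, ∑ h, |V' w x h a| * Real.exp (σ * (l1 (w - c') + l1 (x - c')))
      ≤ S₁ * S₂ * Real.exp (-σ * l1 (c' - c))
        * ∑' p : Site D × Site D, ∑ g, ∑ f, |V' p.1 p.2 g f| * Real.exp (σ * (l1 (p.1 - c') + l1 (p.2 - c'))) := by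
    rw [← tsum_tsum_snd_eq (Φ := fun w x => ∑ h, ∑ a, |V' w x h a| * Real.exp (σ * (l1 (w - c') + l1 (x - c')))) hV',
      ← tsum_mul_left]
    exact Summable.tsum_le_tsum hpt hxs (hcolV'.mul_left _)
  rw [hz]
  have hMV : 0 ≤ ∑' p : Site D × Site D, ∑ g, ∑ f, |V p.1 p.2 g f| * Real.exp (σ * (l1 (p.1 - c) + l1 (p.2 - c))) :=
    tsum_nonneg fun p => Finset.sum_nonneg fun g _ => Finset.sum_nonneg fun f _ => by positivity
  refine (mul_le_mul_of_nonneg_right hx hMV).trans (le_of_eq ?_)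
  ring

end Bubble

end Summit.QuantumFields.BalabanUV.Beta.D1BFx.GhostWordEnvelope

end
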